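import Literature.AlgebraicGeometry.HodgeTheory.FermatInductiveClaimsProofs
import Literature.AlgebraicGeometry.HodgeTheory.ShiodaClaimPairedProofs
import Literature.AlgebraicGeometry.HodgeTheory.FermatAokiStandardCharacter
import Literature.AlgebraicGeometry.HodgeTheory.FermatClaimPermutationInvariance
import Literature.RingTheory.KrullDimension.AffineDimension
import Mathlib.RingTheory.KrullDimension.NonZeroDivisors
import Mathlib.RingTheory.KrullDimension.Polynomial
import Mathlib.RingTheory.KrullDimension.Field
import Mathlib.RingTheory.Polynomial.Vieta
import HarnessLib

/-!
# Aoki's subvariety `Y ⊂ X^{p-1}ₘ` has codimension `≥ r` (Prop. 3-1, dimension half), and the assembly of Thm. 2-1 from a class supported on `Y`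

Family `hodge`, layer `Literature/AlgebraicGeometry/HodgeTheory`. PROOF FILE (sequel of
`FermatInductiveClaimsProofs`) for the named fact `Aoki1987_claim_pStandard` of
`FermatInductiveClaims` — Aoki, J. Math. Soc. Japan 39 (1987) 385–396, THEOREM 2-1 (p. 388): for
`p = 2r + 1` an odd prime, `m = pd`, `(a, d) = 1`, the variety

  `Y : x₀^{kd} + x₁^{kd} + ⋯ + x_{p-1}^{kd} = 0 (1 ≤ k ≤ r),  x_pᵖ - c·x₀x₁⋯x_{p-1} = 0`  (2.1)

(`c = εᵖ ᵈ√p`, `cᵈ = -p`) "is a subvariety of `X^{p-1}ₘ` of codimension `r` and it represents the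
class `σ_{p,a}`", whence claim(σ_{p,a}) ("represents ⟹ claim", p. 386). Everything here is PROVED;
no named fact is introduced (D-0026).

What this file adds, on the tree's carriers and in the cycle-map-free language of
`AlgebraicClasses` (`algebraicClasses = Nʳ H²ʳ`: a class is algebraic iff it dies on the complex
points of the complement of a Zariski-closed subset of codimension `≥ r` pointwise), mirroring
what `ShiodaClaimPairedProofs` does for Shioda's linear spaces (Thm. 1-1):

* `Aoki1987.aokiEquations r d c` — the `r + 1` forms of (2.1) in `ℂ[x₀, …, x_p]` (with the power
  sums `Σᵢ xᵢ^{kd}` replaced by the elementary symmetric functions `e_k(x₀ᵈ, …, x_{p-1}ᵈ)`,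
  `1 ≤ k ≤ r`, which generate the same ideal over `ℚ` by Newton's identities — the form in which
  `FermatInductiveClaimsProofs` proves PROP. 3-1 (i) `Y ⊂ X`, `Aoki1987.fermatPolynomial_mem_idealY`);
  `Aoki1987.aokiSubvariety r d c = V₊(aokiEquations) ⊆ ℙᵖ` and its trace
  `Aoki1987.fermatAokiSection m r d c ⊆ X^{p-1}ₘ` (preimage under the closed immersion
  `X^{p-1}ₘ ↪ ℙᵖ`; equal to `Y` itself when `m = pd`, `cᵈ = -p`, by Prop. 3-1 (i)).
* **PROP. 3-1, dimension half: `Y` has codimension `≥ r` in `X^{p-1}ₘ` at every point**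
  (`Aoki1987.le_coheight_of_mem_fermatAokiSection`). Printed proof (p. 389): `Y` is cut out by
  `r + 1` equations and is finite over the `r`-fold `{e₁ = ⋯ = e_r = 0} ⊂ ℙ^{p-1}` in the
  `yᵢ = xᵢᵈ`. Formal route: the homogeneous coordinate ring `ℂ[x₀, …, x_p]/I_Y` is INTEGRAL over
  the polynomial ring `ℂ[T₀, …, T_r]`, `T_j ↦ e_{r+1+j}(x₀ᵈ, …, x_{p-1}ᵈ)` (Vieta:
  `∏ᵢ (T + yᵢ) = Σ_k e_k(y) T^{p-k}` with `e₁, …, e_r ∈ I_Y` is a monic relation for `-y_j` over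
  `ℂ[e_{r+1}, …, e_p]`; `x_jᵈ = y_j`; `x_pᵖ = c·x₀⋯x_{p-1}`), so `dim ℂ[x]/I_Y ≤ r + 1`
  (`Aoki1987.ringKrullDim_quotient_aokiEquations_le`; incomparability
  `Literature.RingTheory.KrullDimension.ringKrullDim_le_of_isIntegral` and Mathlib's
  `dim k[T₀, …, T_r] = r + 1`); a chain of specialisations below a point `w ∈ V₊(I)` of `ℙᴺ_k` is
  a chain of primes above `𝔭_w ⊇ I` which can be topped by the irrelevant ideal, so
  `dim {w}⁻ = height w ≤ dim k[x]/I - 1` (`height_le_of_ringKrullDim_quotient_le`); closed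
  immersions do not decrease `height`, and `height + coheight = 2r` on the smooth irreducible
  `X²ʳₘ` (`le_coheight_add_of_mem_zeroLocus_of_ringKrullDim_le`, as in
  `le_coheight_add_of_mem_zeroLocus_linearForms` of `ShiodaClaimPairedProofs`).
* **Assembly** `Aoki1987_claim_pStandard_of_subvariety_represents`: the named fact follows from
  (I) `hE1` — `dim V(α) ≤ 1` on `𝔄²ʳₘ` (Ran Prop. 1.7 (i), "well known", p. 385; NOT in the tree) and
  (II) the cohomological half of Thm. 2-1 — some class supported on `Y` (classically `cl(Y)`;
  `ω_σ(Y)·\overline{ω_σ(Y)} = (-1)ʳ p^{p-2} mᵖ ≠ 0`, §§3–4: intersection numbers `Y·Yᵍ` and the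
  Hodge index theorem; NOT in the tree: no cycle class map / intersection pairing on
  `H*(X(ℂ); ℂ)` yet) has non-zero `σ_{p,a}`-component — via "represents ⟹ claim"
  (`FermatCharacter.claim_of_supportedClass`) for Aoki's order of coordinates
  (`FermatCharacter.aokiStandard`) and permutation invariance of claim(α)
  (`FermatCharacter.Claim.of_univ_val_map_eq`) for the fact's `σ ∼ σ_{p,a}`.

## What is NOT here

(I) and (II) above (the theories named in the module docstring of `FermatInductiveClaimsProofs`);
the equality `codim Y = r`, `deg Y = p·r!·dʳ`, `G_Y = G₀ ∩ Ker σ` (Prop. 3-1 (ii)–(v)) — not needed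
for "represents ⟹ claim", which only uses `codim ≥ r`.

## References

* [Aoki1987] N. Aoki, Some new algebraic cycles on Fermat varieties, J. Math. Soc. Japan 39 (1987)
  385–396, doi:10.2969/jmsj/03930385: (2.1) and Thm. 2-1 (p. 388), §3 notation and Prop. 3-1
  (p. 389), p. 386 ("represents ⟹ claim") (text read, J-STAGE open access).
* [Hartshorne1977] R. Hartshorne, Algebraic Geometry (1977), I Thm. 1.8A and Ex. 2.6–2.7
  (dimension of projective varieties via the homogeneous coordinate ring), II Ex. 3.20.
* [Matsumura1987] H. Matsumura, Commutative Ring Theory, Thm. 9.3 (incomparability).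
-/

noncomputable section

open CategoryTheory AlgebraicGeometry MvPolynomial Finset

universe u

namespace Literature.AlgebraicGeometry.HodgeTheory

open Literature.AlgebraicGeometry.Motives Literature.AlgebraicTopology.SingularHomology

/-! ### The equations (2.1) of `Y` and the dimension of its homogeneous coordinate ring -/

namespace Aoki1987

section Equations

variable {R : Type*} [CommRing R]

/-- **Aoki's equations (2.1) of `Y ⊂ ℙᵖ`**, `p = 2r + 1`, in `R[x₀, …, x_p]` (`x_p = x_{Fin.last}`,
`xᵢ = x_{Fin.castSucc i}`): `f₀ = x_pᵖ - c·x₀⋯x_{p-1}` and `f_k = e_k(x₀ᵈ, …, x_{p-1}ᵈ)`, `1 ≤ k ≤ r`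
(the elementary symmetric functions of the `yᵢ = xᵢᵈ` in place of the printed power sums
`Σᵢ yᵢᵏ`: the same ideal over `ℚ`-algebras by Newton's identities, and the form used by
`Aoki1987.sum_X_pow_mem_idealY` / `fermatPolynomial_mem_idealY`). In print `c = εᵖ ᵈ√p`, `cᵈ = -p`.
[cite: Aoki1987, (2.1) (p. 388) and §3 (p. 389: y_i = x_i^d, f_0, f_i)] -/
def aokiEquations (r d : ℕ) (c : R) : Set (MvPolynomial (Fin (2 * r + 2)) R) :=
  insert (X (Fin.last (2 * r + 1)) ^ (2 * r + 1) - C c * ∏ i : Fin (2 * r + 1), X (Fin.castSucc i))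
    ((fun j ↦ aeval (fun i : Fin (2 * r + 1) ↦
        (X (Fin.castSucc i) : MvPolynomial (Fin (2 * r + 2)) R) ^ d) (esymm (Fin (2 * r + 1)) R j)) ''
      Set.Icc 1 r)

/-- `f₀ = x_pᵖ - c·x₀⋯x_{p-1}` is one of the equations. [cite: Aoki1987, (2.1) (p. 388)] -/
theorem f0_mem_aokiEquations (r d : ℕ) (c : R) :
    X (Fin.last (2 * r + 1)) ^ (2 * r + 1) - C c * ∏ i : Fin (2 * r + 1), X (Fin.castSucc i) ∈
      aokiEquations r d c :=
  Set.mem_insert _ _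

/-- `f_k = e_k(x₀ᵈ, …, x_{p-1}ᵈ)`, `1 ≤ k ≤ r`, is one of the equations.
[cite: Aoki1987, (2.1) (p. 388)] -/
theorem esymm_mem_aokiEquations (r d : ℕ) (c : R) {j : ℕ} (hj : j ∈ Set.Icc 1 r) :
    aeval (fun i : Fin (2 * r + 1) ↦ (X (Fin.castSucc i) : MvPolynomial (Fin (2 * r + 2)) R) ^ d)
        (esymm (Fin (2 * r + 1)) R j) ∈ aokiEquations r d c :=
  Set.mem_insert_of_mem _ ⟨j, hj, rfl⟩

/-- Prop. 3-1 (i) restated for `aokiEquations`: the Fermat form `x₀ᵐ + ⋯ + x_pᵐ`, `m = pd`, lies in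
the ideal of the equations when `cᵈ = -p` (`fermatPolynomial_mem_idealY`).
[cite: Aoki1987, Prop. 3-1 (i) (p. 389)] -/
theorem fermatPolynomial_mem_span_aokiEquations {m : ℕ} (r d : ℕ) (hm : m = (2 * r + 1) * d)
    (c : ℂ) (hc : c ^ d = -((2 * r + 1 : ℕ) : ℂ)) :
    fermatPolynomial ℂ (2 * r) m ∈ Ideal.span (aokiEquations r d c) :=
  fermatPolynomial_mem_idealY r d hm c hc

/-- **Vieta for the variables**: in `R[y₀, …, y_{p-1}]`, `Σ_{k ≤ p} e_k(y)·(-y_j)^{p-k} = 0` — the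
value at `T = -y_j` of `∏ᵢ (T + yᵢ) = Σ_k e_k(y) T^{p-k}` (Mathlib
`MvPolynomial.prod_C_add_X_eq_sum_esymm`). [folklore] -/
theorem sum_esymm_mul_neg_X_pow (p : ℕ) (j : Fin p) :
    ∑ k ∈ range (p + 1), esymm (Fin p) R k * (-X j) ^ (p - k) = (0 : MvPolynomial (Fin p) R) := by
  have h := congrArg (Polynomial.eval (-(X j : MvPolynomial (Fin p) R)))
    (MvPolynomial.prod_C_add_X_eq_sum_esymm R (Fin p))
  simp only [Fintype.card_fin, Polynomial.eval_prod, Polynomial.eval_add, Polynomial.eval_X,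
    Polynomial.eval_C, Polynomial.eval_finsetSum, Polynomial.eval_mul, Polynomial.eval_pow] at h
  rw [← h]
  exact Finset.prod_eq_zero (Finset.mem_univ j) (neg_add_cancel (X j))

/-- Splitting a sum over `[0, 2r+1]` as `[1, r] ∪ {0} ∪ [r+1, 2r+1]`. [folklore] -/
theorem sum_range_two_mul_add_two {M : Type*} [AddCommMonoid M] (r : ℕ) (F : ℕ → M) :
    ∑ x ∈ range (2 * r + 1 + 1), F x =
      (∑ x ∈ range r, F (x + 1)) + F 0 + ∑ i : Fin (r + 1), F (r + 1 + i) := by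
  rw [← Finset.sum_range_add_sum_Ico F (show r + 1 ≤ 2 * r + 1 + 1 by omega),
    Finset.sum_range_succ' F r, Finset.sum_Ico_eq_sum_range,
    show 2 * r + 1 + 1 - (r + 1) = r + 1 by omega,
    ← Fin.sum_univ_eq_sum_range (fun i ↦ F (r + 1 + i)) (r + 1)]

end Equations

section Dimension

variable {k : Type u} [Field k]

/-- **`dim ℂ[x₀, …, x_p]/I_Y ≤ r + 1`** (the affine cone over `Y` has dimension `≤ r + 1`, i.e.
`dim Y ≤ r`; Aoki: "`Y` … of codimension `r`", Prop. 3-1, for `X^{p-1}ₘ` of dimension `2r`). Over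
any field `k` and for `d ≥ 1`: the quotient `k[x]/(aokiEquations)` is integral over the polynomial
ring `k[T₀, …, T_r]` mapping `T_j ↦ e_{r+1+j}(x₀ᵈ, …, x_{p-1}ᵈ)` — `-x_jᵈ` is a root of the monic
`T^p + Σ_j T_j T^{r-j}` (Vieta `∏ᵢ (T + yᵢ) = Σ_k e_k(y) T^{p-k}` with `e₁ = ⋯ = e_r = 0` in the
quotient), so `x_j` is integral (`IsIntegral.of_pow`), and `x_pᵖ = c·x₀⋯x_{p-1}` — hence its Krull
dimension is at most `dim k[T₀, …, T_r] = r + 1` (incomparability,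
`Literature.RingTheory.KrullDimension.ringKrullDim_le_of_isIntegral`; Mathlib
`MvPolynomial.ringKrullDim_of_isNoetherianRing`). [cite: Aoki1987, Prop. 3-1 (p. 389)]
[cite: Matsumura1987, Thm 9.3] -/
theorem ringKrullDim_quotient_aokiEquations_le (r d : ℕ) (hd : 0 < d) (c : k) :
    ringKrullDim (MvPolynomial (Fin (2 * r + 2)) k ⧸ Ideal.span (aokiEquations r d c)) ≤
      (r + 1 : ℕ) := by
  classical
  set A := MvPolynomial (Fin (2 * r + 2)) k with hA
  set I : Ideal A := Ideal.span (aokiEquations r d c) with hI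
  set φ : MvPolynomial (Fin (2 * r + 1)) k →ₐ[k] A :=
    aeval (fun i : Fin (2 * r + 1) ↦ (X (Fin.castSucc i) : A) ^ d) with hφ
  set B := MvPolynomial (Fin (r + 1)) k with hB
  set ψ : B →ₐ[k] A ⧸ I :=
    aeval (fun j : Fin (r + 1) ↦ Ideal.Quotient.mk I (φ (esymm (Fin (2 * r + 1)) k (r + 1 + j))))
    with hψ
  letI : Algebra B (A ⧸ I) := ψ.toRingHom.toAlgebra
  have halg : ∀ b, algebraMap B (A ⧸ I) b = ψ b := fun _ ↦ rfl
  have hψX : ∀ j : Fin (r + 1),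
      ψ (X j) = Ideal.Quotient.mk I (φ (esymm (Fin (2 * r + 1)) k (r + 1 + j))) := fun j ↦ by
    rw [hψ]; exact aeval_X _ _
  have hφX : ∀ j : Fin (2 * r + 1), φ (X j) = X (Fin.castSucc j) ^ d := fun j ↦ by
    rw [hφ]; exact aeval_X _ _
  -- constants come from `B`
  have hC : ∀ a : k, algebraMap B (A ⧸ I) (C a) = Ideal.Quotient.mk I (C a) := fun a ↦ by
    rw [halg, hψ, MvPolynomial.aeval_C, ← Ideal.Quotient.mk_algebraMap, MvPolynomial.algebraMap_eq]
  -- the generators `e_1, …, e_r` die in the quotient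
  have he0 : ∀ x ∈ Set.Icc 1 r, Ideal.Quotient.mk I (φ (esymm (Fin (2 * r + 1)) k x)) = 0 :=
    fun x hx ↦ Ideal.Quotient.eq_zero_iff_mem.mpr (Ideal.subset_span (esymm_mem_aokiEquations r d c hx))
  -- (1) the `x_j`, `j < p`, are integral over `B`
  have hcast : ∀ j : Fin (2 * r + 1), IsIntegral B (Ideal.Quotient.mk I (X (Fin.castSucc j))) := by
    intro j
    refine IsIntegral.of_pow hd ?_
    set t : A ⧸ I := Ideal.Quotient.mk I (X (Fin.castSucc j)) ^ d with ht
    -- Vieta pushed to the quotient: `Σ_{x ≤ p} ē_x · (-t)^{p-x} = 0`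
    have hrel := congrArg (fun g ↦ Ideal.Quotient.mk I (φ g))
      (sum_esymm_mul_neg_X_pow (R := k) (2 * r + 1) j)
    simp only [map_sum, map_mul, map_pow, map_neg, map_zero, hφX] at hrel
    rw [← ht, sum_range_two_mul_add_two] at hrel
    -- the terms `1 ≤ x ≤ r` vanish (`e_x ∈ I`), `e_0 = 1`
    have hmid : ∑ x ∈ range r, Ideal.Quotient.mk I (φ (esymm (Fin (2 * r + 1)) k (x + 1))) *
        (-t) ^ (2 * r + 1 - (x + 1)) = 0 := by
      refine Finset.sum_eq_zero fun x hx ↦ ?_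
      rw [Finset.mem_range] at hx
      rw [he0 (x + 1) ⟨by omega, by omega⟩, zero_mul]
    rw [hmid, zero_add, esymm_zero, map_one, map_one, one_mul, Nat.sub_zero] at hrel
    have hrel' : (-t) ^ (2 * r + 1) + ∑ i : Fin (r + 1),
        Ideal.Quotient.mk I (φ (esymm (Fin (2 * r + 1)) k (r + 1 + i))) * (-t) ^ (r - (i : ℕ)) = 0 := by
      refine Eq.trans ?_ hrel
      congr 1
      exact Finset.sum_congr rfl fun i _ ↦ by
        rw [show 2 * r + 1 - (r + 1 + (i : ℕ)) = r - i by omega]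
    -- the monic relation over `B`
    set P : Polynomial B := Polynomial.X ^ (2 * r + 1) +
      ∑ i : Fin (r + 1), Polynomial.C (X i) * Polynomial.X ^ (r - (i : ℕ)) with hP
    have hdeg : (∑ i : Fin (r + 1), Polynomial.C (X i : B) * Polynomial.X ^ (r - (i : ℕ))).degree <
        ((2 * r + 1 : ℕ) : WithBot ℕ) := by
      refine (Polynomial.degree_sum_le _ _).trans_lt ?_
      refine (Finset.sup_lt_iff (WithBot.bot_lt_coe _)).mpr fun i _ ↦ ?_
      refine (Polynomial.degree_C_mul_X_pow_le _ _).trans_lt ?_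
      exact_mod_cast (show r - (i : ℕ) < 2 * r + 1 by omega)
    have hPmonic : P.Monic := Polynomial.monic_X_pow_add hdeg
    have hneg : IsIntegral B (-t) := by
      refine ⟨P, hPmonic, ?_⟩
      simp only [hP, Polynomial.eval₂_add, Polynomial.eval₂_X_pow, Polynomial.eval₂_finsetSum,
        Polynomial.eval₂_mul, Polynomial.eval₂_C, halg, hψX]
      exact hrel'
    have hnn := hneg.neg
    rwa [neg_neg] at hnn
  -- (2) `x_p` is integral over `B`: `x_pᵖ = c·x₀⋯x_{p-1}`
  have hlast : IsIntegral B (Ideal.Quotient.mk I (X (Fin.last (2 * r + 1)))) := by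
    refine IsIntegral.of_pow (Nat.succ_pos (2 * r)) ?_
    have hq : Ideal.Quotient.mk I (X (Fin.last (2 * r + 1))) ^ (2 * r + 1) =
        Ideal.Quotient.mk I (C c * ∏ i : Fin (2 * r + 1), X (Fin.castSucc i)) := by
      rw [← map_pow, Ideal.Quotient.eq]
      exact Ideal.subset_span (f0_mem_aokiEquations r d c)
    rw [hq, map_mul, map_prod, ← hC]
    exact isIntegral_algebraMap.mul (IsIntegral.prod _ fun i _ ↦ hcast i)
  have hX : ∀ i : Fin (2 * r + 2), IsIntegral B (Ideal.Quotient.mk I (X i)) := by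
    intro i
    obtain ⟨j, rfl⟩ | rfl := i.eq_castSucc_or_eq_last
    · exact hcast j
    · exact hlast
  -- (3) every element is integral
  haveI hint : Algebra.IsIntegral B (A ⧸ I) := by
    refine ⟨fun x ↦ ?_⟩
    obtain ⟨f, rfl⟩ := Ideal.Quotient.mk_surjective x
    induction f using MvPolynomial.induction_on with
    | C a => rw [← hC]; exact isIntegral_algebraMap
    | add f g hf hg => rw [map_add]; exact hf.add hg
    | mul_X f i hf => rw [map_mul]; exact hf.mul (hX i)
  -- (4) incomparability and `dim k[T₀, …, T_r] = r + 1`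
  calc ringKrullDim (A ⧸ I) ≤ ringKrullDim B :=
        Literature.RingTheory.KrullDimension.ringKrullDim_le_of_isIntegral
    _ = (r + 1 : ℕ) := by
        change ringKrullDim (MvPolynomial (Fin (r + 1)) k) = ((r + 1 : ℕ) : WithBot ℕ∞)
        rw [MvPolynomial.ringKrullDim_of_isNoetherianRing, ringKrullDim_eq_zero_of_field,
          Nat.card_eq_fintype_card, Fintype.card_fin, zero_add]

end Dimension

end Aoki1987

/-! ### Points of `V₊(I) ⊆ ℙᴺ_k` have dimension `≤ dim k[x]/I - 1` -/

section HeightBound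

variable {k : Type u} [Field k] {N : ℕ}

-- `ℙᴺ_k = Proj k[x₀, …, x_N]` graded by degree (Mathlib's documented idiom for this instance, as in
-- `Motives/ProjectiveSpaceLinearSubspaces` and `ShiodaClaimPairedProofs`)
attribute [local instance] MvPolynomial.gradedAlgebra

/-- Over a field, a proper homogeneous ideal of `k[x₀, …, x_N]` lies in the irrelevant ideal
`(x₀, …, x_N)`: its degree-`0` components are constants, hence `0` (a non-zero constant is a unit).
[folklore] -/
theorem le_irrelevant_of_isHomogeneous_of_ne_top {I : Ideal (MvPolynomial (Fin (N + 1)) k)}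
    (hI : I.IsHomogeneous (MvPolynomial.homogeneousSubmodule (Fin (N + 1)) k)) (hne : I ≠ ⊤) :
    I ≤ (HomogeneousIdeal.irrelevant (MvPolynomial.homogeneousSubmodule (Fin (N + 1)) k)).toIdeal := by
  intro x hx
  rw [← MvPolynomial.sum_homogeneousComponent x]
  refine Ideal.sum_mem _ fun n _ ↦ ?_
  rcases Nat.eq_zero_or_pos n with rfl | hn
  · have h0 : homogeneousComponent 0 x ∈ I := MvPolynomial.homogeneousComponent_mem_of_mem hI hx 0
    rw [homogeneousComponent_zero] at h0 ⊢
    by_cases hc : coeff 0 x = 0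
    · rw [hc, map_zero]
      exact Ideal.zero_mem _
    · exact absurd (Ideal.eq_top_of_isUnit_mem _ h0 ((isUnit_iff_ne_zero.mpr hc).map C)) hne
  · exact HomogeneousIdeal.mem_iff.mpr
      (HomogeneousIdeal.mem_irrelevant_of_mem _ hn (homogeneousComponent_mem n x))

/-- The irrelevant ideal `(x₀, …, x_N)` of `k[x₀, …, x_N]` is prime (the kernel of `f ↦ f(0)` onto
the domain `k ⊆ k[x]`). [folklore] -/
theorem isPrime_irrelevant_toIdeal :
    ((HomogeneousIdeal.irrelevant (MvPolynomial.homogeneousSubmodule (Fin (N + 1)) k)).toIdeal :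
      Ideal (MvPolynomial (Fin (N + 1)) k)).IsPrime := by
  rw [HomogeneousIdeal.toIdeal_irrelevant]
  exact RingHom.ker_isPrime _

/-- **Points of `V₊(I)` have dimension `≤ dim k[x]/I - 1`.** For an ideal `I ⊆ k[x₀, …, x_N]` with
`dim k[x]/I ≤ e + 1` and a point `w` of `ℙᴺ_k = Proj k[x]` whose relevant homogeneous prime `𝔭_w`
contains `I`, `height w = dim {w}⁻ ≤ e`: a chain of specialisations `w₀ < ⋯ < w_ℓ = w` below `w`
(`a ≤ b ↔ b ⤳ a`, reverse inclusion of the primes, `projectiveSpace_le_iff`) is a chain of primes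
`𝔭_w ⊊ ⋯ ⊊ 𝔭_{w₀}` of `k[x]` containing `I`, all relevant hence strictly below the irrelevant prime
`(x₀, …, x_N)` (`le_irrelevant_of_isHomogeneous_of_ne_top`), so `ℓ + 1 ≤ dim k[x]/I`
(`ringKrullDim_quotient`). Hartshorne I Ex. 2.6–2.7 / Thm. 1.8A: `dim Y = dim S(Y) - 1` for a
projective variety with homogeneous coordinate ring `S(Y)`; only the inequality is proved here.
[cite: Hartshorne1977, I Ex. 2.6 and Ex. 2.7] -/
theorem height_le_of_ringKrullDim_quotient_le {I : Ideal (MvPolynomial (Fin (N + 1)) k)} {e : ℕ}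
    (hI : ringKrullDim (MvPolynomial (Fin (N + 1)) k ⧸ I) ≤ (e + 1 : ℕ))
    {w : ↥(projectiveSpace N k).left}
    (hw : I ≤ (ProjectiveSpectrum.asHomogeneousIdeal
      (𝒜 := MvPolynomial.homogeneousSubmodule (Fin (N + 1)) k) w).toIdeal) :
    Order.height w ≤ e := by
  classical
  -- the prime of a point, antitone in the point
  let P : ↥(projectiveSpace N k).left → Ideal (MvPolynomial (Fin (N + 1)) k) := fun v ↦
    (ProjectiveSpectrum.asHomogeneousIdeal
      (𝒜 := MvPolynomial.homogeneousSubmodule (Fin (N + 1)) k) v).toIdeal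
  have hPprime : ∀ v, (P v).IsPrime := fun v ↦
    (v : ProjectiveSpectrum (MvPolynomial.homogeneousSubmodule (Fin (N + 1)) k)).isPrime
  have hPmono : ∀ {a b : ↥(projectiveSpace N k).left}, a ≤ b → P b ≤ P a := fun hab ↦
    projectiveSpace_le_iff.mp hab
  have hPanti : ∀ {a b : ↥(projectiveSpace N k).left}, a < b → P b < P a := by
    intro a b hab
    rw [lt_iff_le_not_ge] at hab
    exact lt_of_le_not_ge (hPmono hab.1) fun h ↦ hab.2 (projectiveSpace_le_iff.mpr h)
  -- the irrelevant prime tops every `P v` strictly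
  set M : Ideal (MvPolynomial (Fin (N + 1)) k) :=
    (HomogeneousIdeal.irrelevant (MvPolynomial.homogeneousSubmodule (Fin (N + 1)) k)).toIdeal with hM
  have hMprime : M.IsPrime := isPrime_irrelevant_toIdeal
  have hPM : ∀ v, P v < M := fun v ↦ by
    refine lt_of_le_of_ne (le_irrelevant_of_isHomogeneous_of_ne_top
      (ProjectiveSpectrum.asHomogeneousIdeal
        (𝒜 := MvPolynomial.homogeneousSubmodule (Fin (N + 1)) k) v).isHomogeneous (hPprime v).ne_top)
      fun h ↦ ?_
    exact (v : ProjectiveSpectrum (MvPolynomial.homogeneousSubmodule (Fin (N + 1)) k))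
      |>.not_irrelevant_le (le_of_eq (HomogeneousIdeal.ext h.symm))
  apply Order.height_le
  intro q hq
  -- the points of the chain contain `I`
  have hIq : ∀ i, I ≤ P (q i) := fun i ↦
    hw.trans (hPmono (hq ▸ q.monotone (Fin.le_last i)))
  have hIM : I ≤ M := (hIq 0).trans (hPM _).le
  -- the reversed chain of primes in `V(I) ⊆ Spec k[x]`
  let g : Fin (q.length + 1) →
      PrimeSpectrum.zeroLocus (R := MvPolynomial (Fin (N + 1)) k) (I : Set _) :=
    fun i ↦ ⟨⟨P (q (Fin.rev i)), hPprime _⟩, hIq _⟩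
  have hg : StrictMono g := fun i j hij ↦ by
    change (⟨P (q (Fin.rev i)), hPprime _⟩ : PrimeSpectrum (MvPolynomial (Fin (N + 1)) k)) <
      ⟨P (q (Fin.rev j)), hPprime _⟩
    rw [← PrimeSpectrum.asIdeal_lt_asIdeal]
    exact hPanti (q.strictMono (Fin.rev_lt_rev.mpr hij))
  let q₁ : LTSeries (PrimeSpectrum.zeroLocus (R := MvPolynomial (Fin (N + 1)) k) (I : Set _)) :=
    { length := q.length, toFun := g, step := fun _ ↦ hg Fin.castSucc_lt_succ }
  let top : PrimeSpectrum.zeroLocus (R := MvPolynomial (Fin (N + 1)) k) (I : Set _) :=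
    ⟨⟨M, hMprime⟩, hIM⟩
  have hlast : q₁.last < top := by
    change (⟨P (q (Fin.rev (Fin.last q.length))), hPprime _⟩ :
        PrimeSpectrum (MvPolynomial (Fin (N + 1)) k)) < ⟨M, hMprime⟩
    rw [← PrimeSpectrum.asIdeal_lt_asIdeal]
    exact hPM _
  have hlen := Order.LTSeries.length_le_krullDim (q₁.snoc top hlast)
  rw [← ringKrullDim_quotient] at hlen
  have h1 : (((q₁.snoc top hlast).length : ℕ) : WithBot ℕ∞) ≤ (e + 1 : ℕ) := hlen.trans hI
  have h2 : (q₁.snoc top hlast).length ≤ e + 1 := by exact_mod_cast h1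
  have h3 : (q₁.snoc top hlast).length = q.length + 1 := by simp [q₁]
  exact_mod_cast (show q.length ≤ e by omega)

end HeightBound

/-! ### Sections of a smooth projective variety by `V₊(I)` have codimension `≥ dim - (dim k[x]/I - 1)` -/

section Codimension

attribute [local instance] MvPolynomial.gradedAlgebra

variable {N d e : ℕ} {Y : Motives.SchemeOver ℂ}

/-- **Codimension of a section `Y ∩ V₊(I)`.** Let `Y` be smooth projective of dimension `d` over `ℂ`
with a closed immersion `ι : Y ↪ ℙᴺ_ℂ`, and `I ⊆ ℂ[x₀, …, x_N]` an ideal with `dim ℂ[x]/I ≤ e + 1`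
(so `V₊(I)` has dimension `≤ e`). Every `z ∈ Y` with `ι(z) ∈ V₊(I)` has `coheight z + e ≥ d`, i.e.
codimension `≥ d - e` in `Y`: `dim {z}⁻ = height z ≤ height ι(z) ≤ e`
(`height_le_height_base_of_isClosedImmersion`, `height_le_of_ringKrullDim_quotient_le`) and
`height z + coheight z = d` on the smooth irreducible `Y`
(`Motives.height_add_coheight_eq_of_smoothOfRelativeDimension`, Hartshorne II Ex. 3.20).
[cite: Hartshorne1977, I Ex. 2.7 and II Ex. 3.20] -/
theorem le_coheight_add_of_mem_zeroLocus_of_ringKrullDim_le (hY : IsSmoothProjective d Y)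
    (ι : Y ⟶ projectiveSpace N ℂ) [IsClosedImmersion ι.left]
    {I : Ideal (MvPolynomial (Fin (N + 1)) ℂ)}
    (hI : ringKrullDim (MvPolynomial (Fin (N + 1)) ℂ ⧸ I) ≤ (e + 1 : ℕ)) {z : Y.left}
    (hz : ι.left.base z ∈
      ProjectiveSpectrum.zeroLocus (MvPolynomial.homogeneousSubmodule (Fin (N + 1)) ℂ)
        (I : Set (MvPolynomial (Fin (N + 1)) ℂ))) :
    (d : ℕ∞) ≤ Order.coheight z + e := by
  have h2 : Order.height (ι.left.base z) ≤ e := height_le_of_ringKrullDim_quotient_le hI hz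
  have h3 : Order.height z ≤ e := (height_le_height_base_of_isClosedImmersion ι.left z).trans h2
  haveI := hY.smoothOfRelativeDimension
  haveI := hY.geometricallyIrreducible
  haveI : IrreducibleSpace ↥Y.left := GeometricallyIrreducible.irreducibleSpace_of_subsingleton Y.hom
  have hsum : Order.height z + Order.coheight z = d :=
    Motives.height_add_coheight_eq_of_smoothOfRelativeDimension Y.hom d z
  calc (d : ℕ∞) = Order.height z + Order.coheight z := hsum.symm
    _ ≤ (e : ℕ∞) + Order.coheight z := add_le_add h3 le_rfl
    _ = Order.coheight z + e := add_comm _ _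

end Codimension

/-! ### Aoki's `Y ⊆ X^{p-1}ₘ` as a Zariski-closed subset of codimension `≥ r` -/

namespace Aoki1987

section Subvariety

attribute [local instance] MvPolynomial.gradedAlgebra

variable {m r d : ℕ}

/-- **`Y = V₊(f₀, f₁, …, f_r) ⊆ ℙᵖ_ℂ`** (`p = 2r + 1`), the projective zero locus of Aoki's equations
(2.1), as a subset of the scheme `ℙ²ʳ⁺¹_ℂ = Proj ℂ[x₀, …, x_{2r+1}]`.
[cite: Aoki1987, (2.1) and Thm. 2-1 (p. 388)] -/
def aokiSubvariety (r d : ℕ) (c : ℂ) : Set ↥(projectiveSpace (2 * r + 1) ℂ).left :=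
  ProjectiveSpectrum.zeroLocus (MvPolynomial.homogeneousSubmodule (Fin (2 * r + 2)) ℂ)
    (aokiEquations r d c)

/-- `Y ⊆ ℙᵖ` is Zariski-closed. [folklore] -/
theorem isClosed_aokiSubvariety (r d : ℕ) (c : ℂ) : IsClosed (aokiSubvariety r d c) :=
  ProjectiveSpectrum.isClosed_zeroLocus _ _

/-- `Y ⊆ V₊(x₀ᵐ + ⋯ + x_pᵐ)` set-theoretically when `m = pd`, `cᵈ = -p` (Prop. 3-1 (i),
`zeroLocus_idealY_subset`). [cite: Aoki1987, Prop. 3-1 (i) (p. 389)] -/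
theorem aokiSubvariety_subset_zeroLocus_fermatPolynomial (r d : ℕ) (hm : m = (2 * r + 1) * d)
    (c : ℂ) (hc : c ^ d = -((2 * r + 1 : ℕ) : ℂ)) :
    aokiSubvariety r d c ⊆
      ProjectiveSpectrum.zeroLocus (MvPolynomial.homogeneousSubmodule (Fin (2 * r + 2)) ℂ)
        {fermatPolynomial ℂ (2 * r) m} :=
  zeroLocus_idealY_subset r d hm c hc

variable (m) in
/-- **The trace of `Y` on the standard model `X²ʳₘ = X^{p-1}ₘ`**: the preimage of
`V₊(f₀, …, f_r) ⊆ ℙᵖ` under the closed immersion `X^{p-1}ₘ ↪ ℙᵖ`, a subset of the scheme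
`fermatHypersurface (2r) m` — for `m = pd` and `cᵈ = -p` this is Aoki's `Y ⊂ X^{p-1}ₘ` itself
(Prop. 3-1 (i)). [cite: Aoki1987, Thm. 2-1 (p. 388) and Prop. 3-1 (i) (p. 389)] -/
def fermatAokiSection (r d : ℕ) (c : ℂ) : Set ↥(fermatHypersurface (2 * r) m).left :=
  (SmoothHypersurface.hypersurfaceι (fermatPolynomial ℂ (2 * r) m)).left.base ⁻¹' aokiSubvariety r d c

/-- `Y ∩ X^{p-1}ₘ ⊆ X^{p-1}ₘ` is Zariski-closed. [folklore] -/
theorem isClosed_fermatAokiSection (r d : ℕ) (c : ℂ) : IsClosed (fermatAokiSection m r d c) :=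
  (isClosed_aokiSubvariety r d c).preimage (SmoothHypersurface.hypersurfaceι _).left.continuous

/-- **PROP. 3-1 (dimension half): `Y ⊆ X^{p-1}ₘ` has codimension `≥ r` at every point** (`m ≥ 1`,
`d ≥ 1`, any `c`): `dim ℂ[x₀, …, x_p]/I_Y ≤ r + 1` (`ringKrullDim_quotient_aokiEquations_le`), so
every point of `V₊(I_Y) ⊆ ℙ²ʳ⁺¹` has dimension `≤ r` and its trace on the smooth `2r`-fold `X²ʳₘ`
has codimension `≥ 2r - r = r` pointwise (`le_coheight_add_of_mem_zeroLocus_of_ringKrullDim_le`).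
This is the "subvariety of codimension `r`" half of Thm. 2-1 in the form consumed by
`FermatCharacter.claim_of_supportedClass`. [cite: Aoki1987, Thm. 2-1 (p. 388) and Prop. 3-1 (p. 389)] -/
theorem le_coheight_of_mem_fermatAokiSection (hm : 1 ≤ m) (hd : 0 < d) (c : ℂ)
    {z : ↥(fermatHypersurface (2 * r) m).left} (hz : z ∈ fermatAokiSection m r d c) :
    (r : ℕ∞) ≤ Order.coheight z := by
  rcases Nat.eq_zero_or_pos r with rfl | hr
  · simp
  have hX : IsSmoothProjective (2 * r) (fermatHypersurface (2 * r) m) :=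
    isSmoothProjective_fermatHypersurface (by omega) hm
  have hz' : (SmoothHypersurface.hypersurfaceι (fermatPolynomial ℂ (2 * r) m)).left.base z ∈
      ProjectiveSpectrum.zeroLocus (MvPolynomial.homogeneousSubmodule (Fin (2 * r + 1 + 1)) ℂ)
        ((Ideal.span (aokiEquations r d c) : Ideal (MvPolynomial (Fin (2 * r + 2)) ℂ)) :
          Set (MvPolynomial (Fin (2 * r + 2)) ℂ)) := by
    rw [ProjectiveSpectrum.zeroLocus_span]
    exact hz
  have key := le_coheight_add_of_mem_zeroLocus_of_ringKrullDim_le (N := 2 * r + 1) (e := r) hX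
    (SmoothHypersurface.hypersurfaceι (fermatPolynomial ℂ (2 * r) m))
    (ringKrullDim_quotient_aokiEquations_le r d hd c) hz'
  -- `2r ≤ coheight z + r`
  by_contra hlt
  push Not at hlt
  have hfin : Order.coheight z ≠ ⊤ := (hlt.trans (ENat.coe_lt_top r)).ne
  obtain ⟨n, hn⟩ := ENat.ne_top_iff_exists.mp hfin
  rw [← hn] at key hlt
  have h1' : (2 * r : ℕ) ≤ n + r := by exact_mod_cast key
  have h2' : n < r := by exact_mod_cast hlt
  omega

end Subvariety

end Aoki1987

/-! ### The assembly: Thm. 2-1 from `dim V(α) ≤ 1` and a class supported on `Y` -/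

/-- **`Aoki1987_claim_pStandard` from the eigenspace structure and the cohomological half of
Thm. 2-1.** Granted, on the tree's carriers,
(I) `hE1`: for `r > 0` and `α ∈ 𝔄²ʳₘ` the eigenspace `V(α) ⊆ H²ʳ(X²ʳₘ(ℂ); ℂ)` is at most a line
("`dim V(α) = 1`", p. 385; Ran Prop. 1.7 (i)), and
(II) `hY`: for `p = 2r + 1` prime, `p ∣ m`, `d = m/p > 2`, `(⟨a⟩, d) = 1`, for some constant `c₀`
(in print `c₀ = εᵖ ᵈ√p`) some class `c ∈ H²ʳ(X²ʳₘ(ℂ); ℂ)` SUPPORTED ON `Y = Y_{c₀} ∩ X²ʳₘ`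
(vanishing on `(X ∖ Y)(ℂ)`; classically the multiples of `cl(Y)`) has non-zero
`σ_{p,a}`-component, `σ_{p,a} = (a, a+d, …, a+(p-1)d, -pa)` in Aoki's order of coordinates
(`FermatCharacter.aokiStandard`) — THEOREM 2-1: "`Y` … represents the class `σ_{p,a}`",
`ω_σ(Y)·\overline{ω_σ(Y)} = (-1)ʳ p^{p-2} mᵖ ≠ 0` —
the named fact holds: `Y` is Zariski-closed of codimension `≥ r` pointwise
(`Aoki1987.le_coheight_of_mem_fermatAokiSection`), so "represents ⟹ claim"
(`FermatCharacter.claim_of_supportedClass`, with `σ_{p,a} ∈ 𝔄`, `Aoki1987.isAdmissible_pStandard`)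
gives claim(σ_{p,a}), and claim is invariant under permuting the coordinates
(`FermatCharacter.Claim.of_univ_val_map_eq`) for the fact's `σ ∼ σ_{p,a}`.
[cite: Aoki1987, Thm. 2-1 (p. 388), Prop. 3-1 (p. 389), p. 385 (dim V(α) = 1) and p. 386]
[cite: Ran1980, §1 Prop. 1.7 (i)] -/
theorem Aoki1987_claim_pStandard_of_subvariety_represents
    (hE1 : ∀ (m r : ℕ) [NeZero m] (α : Fin (2 * r + 2) → ZMod m), 0 < r →
      FermatCharacter.IsAdmissible α → ∃ v, fermatEigenspace m α (2 * r) ≤ ℂ ∙ v)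
    (hY : ∀ (m r : ℕ) [NeZero m], (2 * r + 1).Prime → 2 * r + 1 ∣ m → 2 < m / (2 * r + 1) →
      ∀ a : ZMod m, Nat.Coprime a.val (m / (2 * r + 1)) →
      ∃ (c₀ : ℂ) (c : complexBetti (fermatHypersurface (2 * r) m) (2 * r)),
        complexBetti.restrictCompl (fermatHypersurface (2 * r) m)
            (Aoki1987.fermatAokiSection m r (m / (2 * r + 1)) c₀) (2 * r) c = 0 ∧
          fermatProjector m (FermatCharacter.aokiStandard r m a) (2 * r) c ≠ 0) :
    Aoki1987_claim_pStandard := by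
  intro m p r _ hp hpr hpm hd a ha σ hσ
  subst hpr
  have hr : 0 < r := by
    rcases Nat.eq_zero_or_pos r with rfl | h
    · exact absurd hp (by decide)
    · exact h
  obtain ⟨c₀, c, hc, hne⟩ := hY m r hp hpm hd a ha
  have hstd : FermatCharacter.Claim m r (FermatCharacter.aokiStandard r m a) :=
    FermatCharacter.claim_of_supportedClass
      (hE1 m r _ hr (Aoki1987.isAdmissible_pStandard hp rfl hpm hd ha
        (FermatCharacter.univ_val_map_aokiStandard r m a)))
      (Aoki1987.isClosed_fermatAokiSection r _ c₀)
      (fun z hz ↦ Aoki1987.le_coheight_of_mem_fermatAokiSection NeZero.one_le (by omega) c₀ hz) hc hne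
  exact FermatCharacter.Claim.of_univ_val_map_eq
    (hσ.trans (FermatCharacter.univ_val_map_aokiStandard r m a).symm) hstd

end Literature.AlgebraicGeometry.HodgeTheory

end
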